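import Summits.Ventures.PercRepro.RankLevelSetHallRuleLExact

/-!
# PercRepro — THE TOOLS OF THE UNIFORM-FLAT THEOREM FOR RULE L (p4, gen 30; C-044, UP form at the tight layer;
paper proofs/P4-CELL-THREE.md §14.12)

For a member `Z` of the cell `(p, q)` at the tight layer with closure `F = cl Z`, under (U) «every subset of `F` with at
most `q` elements is independent»: a free set `X_D ⊆ E ∖ F` with `Z ∪ X_D` independent and any size `≤ p − q` exists
(`exists_free_indep`: a basis of `Z ∪ (E ∖ F)` through `Z` has `≥ p` elements because `r(Z ∪ (E ∖ F)) ≥ r(E ∖ Z) = p`);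
an independent subset of `F` stays independent after adjoining any part of `X_D` (`indep_union_of_subset_closure`,
submodularity against `F`); hence a member of `S = Z ∪ X_P ∪ X_D` (`X_P ⊆ flatPart Z`) that meets `X_D` is NOT eligible
in `S` — every `insert e Z′`, `e ∈ S ∖ Z′`, is independent (`not_eligible_of_inter_free`) — and the eligible members of
`S` are `q`-subsets of `Z ∪ X_P`: `eligCount S ≤ C(#(Z ∪ X_P), q)` (`eligCount_le_choose_of_uniform`).  The theorem itself
(`ruleL_pays_of_uniform_flat`) is in RankLevelSetHallRuleLUniform.  Axioms standard.
-/

namespace PercRepro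

open Set Matroid Finset

variable {α : Type} (M : Matroid α) [M.Finite]

/-- **The submodular step**: if `Z ∪ X` is independent with `X ⊆ E ∖ cl Z`, `Y ⊆ cl Z` is independent and `T ⊆ X`, then
`Y ∪ T` is independent (`r(Y) + r(cl Z ∪ T) ≤ r(Y ∪ T) + r(cl Z)` with `r(cl Z ∪ T) = #Z + #T`, `r(cl Z) = #Z`). -/
lemma indep_union_of_subset_closure {Z X Y T : Set α} (hZX : M.Indep (Z ∪ X)) (hX : X ⊆ M.E \ M.closure Z)
    (hY : M.Indep Y) (hYZ : Y ⊆ M.closure Z) (hTX : T ⊆ X) : M.Indep (Y ∪ T) := by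
  have hZ : M.Indep Z := hZX.subset Set.subset_union_left
  have hZT : M.Indep (Z ∪ T) := hZX.subset (Set.union_subset_union_right Z hTX)
  have hTE : T ⊆ M.E := fun x hx => (hX (hTX hx)).1
  have hYE : Y ⊆ M.E := hY.subset_ground
  have hZE : Z ⊆ M.E := hZ.subset_ground
  have hTfin : T.Finite := M.set_finite T hTE
  have hYfin : Y.Finite := M.set_finite Y hYE
  have hZfin : Z.Finite := M.set_finite Z hZE
  have hTcl : Disjoint T (M.closure Z) := Set.disjoint_left.2 (fun x hxT hxcl => (hX (hTX hxT)).2 hxcl)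
  have hYT : Disjoint Y T := Set.disjoint_of_subset_left hYZ hTcl.symm
  have hZTd : Disjoint Z T := Set.disjoint_of_subset_left (M.subset_closure Z hZE) hTcl.symm
  -- the two sides of submodularity
  have hsub := M.eRk_inter_add_eRk_union_le (Y ∪ T) (M.closure Z)
  have hinter : (Y ∪ T) ∩ M.closure Z = Y := by
    ext x
    constructor
    · intro hx
      rcases hx.1 with hxY | hxT
      · exact hxY
      · exact absurd hx.2 (Set.disjoint_left.1 hTcl hxT)
    · intro hx
      exact ⟨Or.inl hx, hYZ hx⟩
  have hunion : (Y ∪ T) ∪ M.closure Z = M.closure Z ∪ T := by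
    ext x
    constructor
    · intro hx
      rcases hx with (hxY | hxT) | hxc
      · exact Or.inl (hYZ hxY)
      · exact Or.inr hxT
      · exact Or.inl hxc
    · intro hx
      rcases hx with hxc | hxT
      · exact Or.inr hxc
      · exact Or.inl (Or.inr hxT)
  rw [hinter, hunion, M.eRk_union_closure_left_eq, M.eRk_closure_eq, hZT.eRk_eq_encard, hZ.eRk_eq_encard,
    hY.eRk_eq_encard, Set.encard_union_eq hZTd] at hsub
  -- cancel #Z
  have hZne : Z.encard ≠ ⊤ := hZfin.encard_lt_top.ne
  have h1 : Y.encard + T.encard ≤ M.eRk (Y ∪ T) := by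
    have : Y.encard + T.encard + Z.encard ≤ M.eRk (Y ∪ T) + Z.encard := by
      calc Y.encard + T.encard + Z.encard = Y.encard + (Z.encard + T.encard) := by ring
        _ ≤ M.eRk (Y ∪ T) + Z.encard := hsub
    exact (ENat.add_le_add_iff_right hZne).1 this
  have h2 : M.eRk (Y ∪ T) ≤ (Y ∪ T).encard := M.eRk_le_encard _
  rw [Set.encard_union_eq hYT] at h2
  rw [indep_iff_eRk_eq_encard_of_finite (hYfin.union hTfin), Set.encard_union_eq hYT]
  exact le_antisymm h2 h1

/-- Under (U) a member `Z′` of `S = Z ∪ X_P ∪ X_D` that meets `X_D` is not eligible in `S`: every `insert e Z′`,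
`e ∈ S ∖ Z′`, is independent. -/
lemma not_eligible_of_inter_free {p q : ℕ} (hE : M.E.ncard = p + q) {Z X_P X_D : Set α}
    (hZ : Z ∈ cellMembers M p q) (hU : ∀ A ⊆ M.closure Z, A.ncard ≤ q → M.Indep A)
    (hXP : X_P ⊆ flatPart M Z) (hXD : X_D ⊆ M.E \ M.closure Z) (hZXD : M.Indep (Z ∪ X_D))
    {Z' : Set α} (hZ' : Z' ∈ cellMembers M p q) (hZ'S : Z' ⊆ Z ∪ X_P ∪ X_D) (hmeet : (Z' ∩ X_D).Nonempty) :
    ¬ ∃ e ∈ Z ∪ X_P ∪ X_D, e ∉ Z' ∧ M.eRk (insert e Z') = (q : ℕ∞) := by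
  rintro ⟨e, heS, heZ', hrk⟩
  have hZE : Z ⊆ M.E := hZ.1
  have hZ'E : Z' ⊆ M.E := hZ'.1
  have hZ'card : Z'.ncard = q := ncard_eq_q_of_mem_cellMembers_tight M hE hZ'
  have hZ'fin : Z'.Finite := M.set_finite Z' hZ'E
  have hZ'ind : M.Indep Z' := by
    rw [indep_iff_eRk_eq_encard_of_finite hZ'fin, hZ'.2.1, ← hZ'fin.cast_ncard_eq, hZ'card]
  have hXPcl : X_P ⊆ M.closure Z := fun x hx => (hXP hx).2
  -- split Z' = A ∪ T
  set A := Z' \ X_D with hA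
  set T := Z' ∩ X_D with hT
  have hAcl : A ⊆ M.closure Z := by
    intro x hx
    rcases hZ'S hx.1 with (hxZ | hxP) | hxD
    · exact M.subset_closure Z hZE hxZ
    · exact hXPcl hxP
    · exact absurd hxD hx.2
  have hAT : A ∪ T = Z' := by
    ext x
    constructor
    · rintro (hx | hx)
      · exact hx.1
      · exact hx.1
    · intro hx
      by_cases hxD : x ∈ X_D
      · exact Or.inr ⟨hx, hxD⟩
      · exact Or.inl ⟨hx, hxD⟩
  have hAind : M.Indep A := hZ'ind.subset Set.sdiff_subset
  have hAfin : A.Finite := hZ'fin.subset Set.sdiff_subset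
  have hTfin : T.Finite := hZ'fin.subset Set.inter_subset_left
  have hAT' : Disjoint A T := Set.disjoint_left.2 (fun x hxA hxT => hxA.2 hxT.2)
  have hAcard : A.ncard + T.ncard = q := by
    rw [← Set.ncard_union_eq hAT' hAfin hTfin, hAT, hZ'card]
  have hTpos : 1 ≤ T.ncard := by
    have : 0 < T.ncard := (Set.ncard_pos hTfin).2 hmeet
    omega
  have hTX : T ⊆ X_D := Set.inter_subset_right
  -- insert e Z' is independent
  have hins : M.Indep (insert e Z') := by
    rcases heS with (heZ | heP) | heD
    · -- e ∈ cl Z : A ∪ {e} has ≤ q elements, independent by (U), then add T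
      have hecl : e ∈ M.closure Z := M.subset_closure Z hZE heZ
      have hAe : M.Indep (insert e A) := by
        refine hU _ (Set.insert_subset hecl hAcl) ?_
        rw [Set.ncard_insert_of_notMem (fun h => heZ' h.1) hAfin]
        omega
      have := indep_union_of_subset_closure M hZXD hXD hAe (Set.insert_subset hecl hAcl) hTX
      rw [Set.insert_union, hAT] at this
      exact this
    · have hecl : e ∈ M.closure Z := hXPcl heP
      have hAe : M.Indep (insert e A) := by
        refine hU _ (Set.insert_subset hecl hAcl) ?_
        rw [Set.ncard_insert_of_notMem (fun h => heZ' h.1) hAfin]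
        omega
      have := indep_union_of_subset_closure M hZXD hXD hAe (Set.insert_subset hecl hAcl) hTX
      rw [Set.insert_union, hAT] at this
      exact this
    · -- e ∈ X_D : A stays, T grows
      have := indep_union_of_subset_closure M hZXD hXD hAind hAcl
        (Set.insert_subset heD hTX : insert e T ⊆ X_D)
      rw [Set.union_insert, hAT] at this
      exact this
  -- then its rank is q + 1, not q
  have hrk' : M.eRk (insert e Z') = (insert e Z').encard := hins.eRk_eq_encard
  rw [Set.encard_insert_of_notMem heZ', ← hZ'fin.cast_ncard_eq, hZ'card, hrk] at hrk'
  have hq : q = q + 1 := by exact_mod_cast hrk'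
  omega

/-- Under (U), the eligible members of `S = Z ∪ X_P ∪ X_D` number at most `C(#(Z ∪ X_P), q)`. -/
lemma eligCount_le_choose_of_uniform {p q : ℕ} (hE : M.E.ncard = p + q) {Z X_P X_D : Set α}
    (hZ : Z ∈ cellMembers M p q) (hU : ∀ A ⊆ M.closure Z, A.ncard ≤ q → M.Indep A)
    (hXP : X_P ⊆ flatPart M Z) (hXD : X_D ⊆ M.E \ M.closure Z) (hZXD : M.Indep (Z ∪ X_D)) :
    eligCount M p q (Z ∪ X_P ∪ X_D) ≤ (Z ∪ X_P).ncard.choose q := by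
  have hZE : Z ⊆ M.E := hZ.1
  have hGE : Z ∪ X_P ⊆ M.E := Set.union_subset hZE (fun x hx => (hXP hx).1.1)
  refine le_trans ?_ (ncard_members_subset_le_choose M hE hGE)
  unfold eligCount
  refine Set.ncard_le_ncard ?_ ((cellMembers_finite M p q).subset (fun _ h => h.1))
  intro Z' hZ'
  obtain ⟨hmem, hsub, helig⟩ := hZ'
  refine ⟨hmem, ?_⟩
  by_contra hnot
  have hmeet : (Z' ∩ X_D).Nonempty := by
    rw [Set.nonempty_iff_ne_empty]
    intro hempty
    apply hnot
    intro x hx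
    rcases hsub hx with hxG | hxD
    · exact hxG
    · exact absurd (show x ∈ Z' ∩ X_D from ⟨hx, hxD⟩) (by rw [hempty]; exact id)
  exact not_eligible_of_inter_free M hE hZ hU hXP hXD hZXD hmem hsub hmeet helig

/-- At the tight layer a member `Z` has a free set `X_D ⊆ E ∖ cl Z` of any size `≤ p − q` with `Z ∪ X_D` independent. -/
lemma exists_free_indep {p q : ℕ} (hE : M.E.ncard = p + q) {Z : Set α} (hZ : Z ∈ cellMembers M p q) (n : ℕ)
    (hn : n ≤ p - q) : ∃ X_D ⊆ M.E \ M.closure Z, X_D.ncard = n ∧ M.Indep (Z ∪ X_D) := by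
  have hZE : Z ⊆ M.E := hZ.1
  have hEfin : M.E.Finite := M.ground_finite
  have hZcard : Z.ncard = q := ncard_eq_q_of_mem_cellMembers_tight M hE hZ
  have hZfin : Z.Finite := hEfin.subset hZE
  have hZind : M.Indep Z := by
    rw [indep_iff_eRk_eq_encard_of_finite hZfin, hZ.2.1, ← hZfin.cast_ncard_eq, hZcard]
  -- a basis of Z ∪ (E ∖ cl Z) through Z
  set W : Set α := Z ∪ (M.E \ M.closure Z) with hW
  have hWE : W ⊆ M.E := Set.union_subset hZE Set.sdiff_subset
  obtain ⟨J, hJ, hZJ⟩ := hZind.subset_isBasis_of_subset (Set.subset_union_left : Z ⊆ W) hWE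
  -- r(W) ≥ r(E ∖ Z) = p : every element of E ∖ Z lies in cl Z or in E ∖ cl Z, so E ∖ Z ⊆ cl Z ∪ (E ∖ cl Z) = cl W
  have hcompl : M.E \ Z ⊆ M.closure W := by
    intro x hx
    by_cases hxc : x ∈ M.closure Z
    · exact M.closure_subset_closure (Set.subset_union_left : Z ⊆ W) hxc
    · exact M.subset_closure W hWE (Or.inr ⟨hx.1, hxc⟩)
  have hrW : (p : ℕ∞) ≤ M.eRk W := by
    calc (p : ℕ∞) = M.eRk (M.E \ Z) := hZ.2.2.symm
      _ ≤ M.eRk (M.closure W) := M.eRk_mono hcompl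
      _ = M.eRk W := M.eRk_closure_eq W
  have hJcard : p ≤ J.ncard := by
    have hJfin : J.Finite := hEfin.subset hJ.indep.subset_ground
    have : (p : ℕ∞) ≤ (J.ncard : ℕ∞) := by
      rw [hJfin.cast_ncard_eq, ← hJ.eRk_eq_encard]; exact hrW
    exact_mod_cast this
  -- X := J ∖ Z ⊆ E ∖ cl Z has ≥ p − q elements
  have hJZ : J \ Z ⊆ M.E \ M.closure Z := by
    intro x hx
    rcases hJ.subset hx.1 with hxZ | hxD
    · exact absurd hxZ hx.2
    · exact hxD
  have hJfin : J.Finite := hEfin.subset hJ.indep.subset_ground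
  have hJZcard : p - q ≤ (J \ Z).ncard := by
    have h1 : J.ncard = Z.ncard + (J \ Z).ncard := by
      rw [← Set.ncard_union_eq Set.disjoint_sdiff_right hZfin (hJfin.subset Set.sdiff_subset),
        Set.union_sdiff_cancel hZJ]
    omega
  obtain ⟨X_D, hXDsub, hXDcard⟩ := Set.exists_subset_card_eq (le_trans hn hJZcard)
  refine ⟨X_D, hXDsub.trans hJZ, hXDcard, hJ.indep.subset ?_⟩
  exact Set.union_subset hZJ (hXDsub.trans Set.sdiff_subset)

end PercRepro
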